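import Summits.QuantumFields.YangMills.Theorems.BalabanUVNodesPortS1QtCPsiBall
import Summits.QuantumFields.YangMills.Theorems.BalabanUVNodesPortS1RecordDt

/-!
# Port S1, socket (o3)-III — `D̃ = recordDt` IS A FRÉCHET-HOLOMORPHIC (ANALYTIC) FUNCTION OF `B` ON ITS BALL, WITH THE JACOBIAN IDENTITY
# `1 − h_ℂ∘DD̃(B) = (DΨ(Φ B))⁻¹ = (1 + h_ℂ∘DC̃_ℂ(B − h_ℂD̃(B)))⁻¹` AND `det(1 − h_ℂ∘DD̃(B)) · det(DΨ(Φ B)) = 1` ([I] p.267 «it is an analytic function of B»; (2.12) p.268 «Tr log(I − h (δ∕δB)D̃)»)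

Cell `ym-nodeO-ideate`, porter seat PT-A-1 (gen 10); `--kind proof --supports stmt-QuantumFields-27930 --as helper`; count-neutral.  [I] = [Balaban1987RG1]; [15] = [Balaban1985Variational].
Director-ym №607 ∕ R702-ym docket (1)+(2): the (o3) Jacobian of print's translation at the NAME `recordDt` (✓p828226) and the `recordDt`-specialisations of the change of variables; over ✓`…PortS1QtCPsiBall`
(p828597: `Ψ` strictly differentiable, a unit derivative and injective on the `2ρ`-ball, the `9C₂ρ`-Lipschitz bound of `C̃_ℂ`).

WHAT IS PROVED (letters (o1-ε) at a QUANTIFIED radius `ρ`: loops `ε`-close (`ε ≤ 1∕50`), the (0.4) guard, `‖h_ℂ‖ ≤ b`, `9C₂bρ < 1`, `3ρ ≤ R`; `R = 1∕(10⁸dL)`, `C₂ = 2∕R²`; `Φ B := B − h_ℂ D̃(B)`,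
`Ψ B′ := B′ + h_ℂ C̃_ℂ(B′)`, `DΨ(Y) := 1 + h_ℂ ∘L DC̃_ℂ(Y)`, all written out):
* §1 (docket (2): the change of variables AT THE NAME) `recordDt_eq_recordCtC_recordPhi` (`D̃ = C̃_ℂ ∘ Φ`), `mapsTo_recordPhi_recordDt` (`Φ : ball ρ → ball 2ρ`), `norm_recordPhi_recordDt_lt`, `injOn_recordPhi_recordDt_ball`,
  `recordPsi_recordPhi_recordDt` (`Ψ ∘ Φ = id` on `ball ρ`), `recordPhi_recordPsi_recordDt_of_norm_lt` (`Φ ∘ Ψ = id` on `ball (ρ∕2)`), `existsUnique_recordPhi_recordDt_eq`.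
* §2 ★ `norm_recordDt_sub_le` — `D̃` IS LIPSCHITZ on `ball ρ`: `(1 − 9C₂bρ)‖D̃ B₁ − D̃ B₂‖ ≤ 9C₂ρ‖B₁ − B₂‖` ([15] (53)–(54) between two base points); `continuousOn_recordDt_ball`, `continuousAt_recordDt`.
* §3 ★★ `hasFDerivAt_recordPhi` — `DΦ(B) = Ring.inverse (DΨ(Φ B))` (Mathlib `HasFDerivAt.of_local_left_inverse`: `Ψ ∘ Φ = id` near `B`, `Φ` continuous, `DΨ(Φ B)` a unit); ★★★ `hasFDerivAt_recordDt` —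
  `DD̃(B) = DC̃_ℂ(Φ B) ∘L Ring.inverse (DΨ(Φ B))` (chain rule on `D̃ = C̃_ℂ ∘ Φ`); ★★★ `differentiableOn_recordDt_ball`, ★★★ `analyticOnNhd_recordDt_ball` — **«D̃(B) … is an analytic function of B»
  IN THE FULL (FRÉCHET, TAYLOR-SERIES) SENSE** (lit ✓`B12Lineariz267` typed complex lines only; here via [Chae1985] Thm 14.13 = tree ✓`HolomorphicBanach.analyticOnNhd_of_differentiableOn`).
* §4 ★★★ `one_sub_hop_comp_fderiv_recordDt` — THE JACOBIAN IDENTITY `1 − h_ℂ ∘L DD̃(B) = Ring.inverse (DΨ(Φ B))`; `fderiv_recordPsi_mul_one_sub_hop_comp_fderiv_recordDt` (both products `= 1`);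
  ★★ `det_one_sub_hop_comp_fderiv_recordDt_mul` (`det(1 − h_ℂ∘DD̃(B)) · det(DΨ(Φ B)) = 1`), `det_fderiv_recordPsi_recordPhi_ne_zero`, ★★ `det_one_sub_hop_comp_fderiv_recordDt_eq_inv` — print's
  `det(1 − h δD̃∕δB)⁻¹ = det(1 + h_ℂ DC̃_ℂ(B′))` at `B′ = Φ(B)`: the (o3) determinant is carried by the EXPLICIT holomorphic family `B′ ↦ 1 + h_ℂ∘DC̃_ℂ(B′)` of ✓`…PortS1QtCPsi`.

HONEST FRAMING.  Calculus over landed estimates (inverse-function bookkeeping); the reality bridge for ★★ DEF-1's `recordDtCorrOf`∕`recordDtJacOf` (real points ↦ `𝔰𝔲(2)`, `Re` exact) and the `Tr log`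
series∕bound are the NEXT bricks; nothing of Bałaban's renormalization-group estimates asserted, ported or discharged beyond this; `stub_FE` (XXL) ∕ `stub_P0C` OPEN, ⟨27930⟩ OPEN (1∕3); NODE O 0∕1;
COUNT 8∕28 · K 1∕4 UNMOVED; finite `𝕋⁴_{L^K}` at fixed ε — NOT continuum ∕ OS; **the Yang–Mills mass gap (Clay) is NOT proved by any of this.**  No `sorry`, no `def`, no `instance`; standard axioms.
-/

noncomputable section

open scoped BigOperators Matrix.Norms.L2Operator Topology

open Set Metric Filter

namespace Summit.QuantumFields.YangMills.Theorems.BalabanUVNodesPortS1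

open Summit.QuantumFields.YangMills.Theorems.K0RecordFormatNames
open Literature.MathematicalPhysics.QuantumFieldTheory.Balaban1983to89
open Literature.MathematicalPhysics.QuantumFieldTheory.Balaban1983to89.Node00
open Literature.MathematicalPhysics.QuantumFieldTheory.Balaban1983to89.T4Continuum (T4Family)
open Literature.MathematicalPhysics.QuantumFieldTheory.Balaban1983to89.BlockAveraging (Small Idx)
open Literature.MathematicalPhysics.QuantumFieldTheory.Balaban1983to89.ExpMeanLog (expMeanLogSU)
open _root_.Matrix

section Letters

variable {F : T4Family}
variable {k K : ℕ} (hk : k + 1 ≤ (F.P K).m + (F.P K).K) (Vk : GaugeField (F.P K) k (SU 2)) {ε : ℝ}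
  (hε : ∀ (c : PBond (F.P K) (k + 1)) (i : Idx (F.P K)), ‖loopM (coeField Vk) c i - 1‖ ≤ ε) (hε50 : ε ≤ 1 / 50)
  (hVk : ∀ c, Small expMeanLogSU Vk c) {b ρ : ℝ} (hb : 0 ≤ b) (hHop : ∀ X, ‖hopLinGraphC F k K Vk X‖ ≤ b * ‖X‖)
  (hq : 9 * (2 * 1 / (1 / (10 ^ 8 * (F.P K).d * (F.P K).L)) ^ 2) * b * ρ < 1) (hρ : 3 * ρ ≤ 1 / (10 ^ 8 * (F.P K).d * (F.P K).L))

/-! ## §1  The change of variables at the NAME `recordDt` (docket (2)) -/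

include hk hε hε50 hVk hb hHop hq hρ in
/-- **THE FIXED-POINT EQUATION AT THE NAME**: `D̃(B) = C̃_ℂ(B − h_ℂ D̃(B)) = C̃_ℂ(Φ B)` for `‖B‖ < ρ`. [cite: Balaban1987RG1, p.267 (displayed equation)] -/
theorem recordDt_eq_recordCtC_recordPhi {B : FluctIdx F k K → ℂ} (hB : ‖B‖ < ρ) :
    recordDt F k K Vk ρ B = recordCtC F k K Vk (B - hopLinGraphC F k K Vk (recordDt F k K Vk ρ B)) :=
  (recordDt_spec F k K hk Vk hε hε50 hVk hb hHop hq hρ hB).2.symm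

include hk hε hε50 hVk hb hHop hq hρ in
/-- `Φ(B) = B − h_ℂ D̃(B)` maps `ball ρ` into `ball 2ρ`. [cite: Balaban1987RG1, p.267–268] -/
theorem mapsTo_recordPhi_recordDt :
    MapsTo (fun B => B - hopLinGraphC F k K Vk (recordDt F k K Vk ρ B)) (ball (0 : FluctIdx F k K → ℂ) ρ) (ball (0 : FluctIdx F k K → ℂ) (2 * ρ)) :=
  mapsTo_recordPhi hk Vk hε hε50 hVk hb hHop hq hρ (fun _ hB => (recordDt_spec F k K hk Vk hε hε50 hVk hb hHop hq hρ hB).1)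
    (fun _ hB => (recordDt_spec F k K hk Vk hε hε50 hVk hb hHop hq hρ hB).2)

include hk hε hε50 hVk hb hHop hq hρ in
/-- `‖Φ(B)‖ < 2ρ` (`≤ R`) for `‖B‖ < ρ`. [cite: Balaban1987RG1, p.267–268] -/
theorem norm_recordPhi_recordDt_lt {B : FluctIdx F k K → ℂ} (hB : ‖B‖ < ρ) :
    ‖B - hopLinGraphC F k K Vk (recordDt F k K Vk ρ B)‖ < 2 * ρ :=
  mem_ball_zero_iff.1 (mapsTo_recordPhi_recordDt hk Vk hε hε50 hVk hb hHop hq hρ (mem_ball_zero_iff.2 hB))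

include hk hε hε50 hVk hb hHop hq hρ in
/-- `Φ` is injective on `ball ρ`. [cite: Balaban1987RG1, p.267–268] -/
theorem injOn_recordPhi_recordDt_ball :
    InjOn (fun B => B - hopLinGraphC F k K Vk (recordDt F k K Vk ρ B)) (ball (0 : FluctIdx F k K → ℂ) ρ) :=
  injOn_recordPhi_ball Vk (fun _ hB => (recordDt_spec F k K hk Vk hε hε50 hVk hb hHop hq hρ hB).2)

include hk hε hε50 hVk hb hHop hq hρ in
/-- ★ **`Ψ ∘ Φ = id` ON `ball ρ`**: `Φ(B) + h_ℂ C̃_ℂ(Φ B) = B`. [cite: Balaban1987RG1, p.267–268] -/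
theorem recordPsi_recordPhi_recordDt {B : FluctIdx F k K → ℂ} (hB : ‖B‖ < ρ) :
    (B - hopLinGraphC F k K Vk (recordDt F k K Vk ρ B)) +
        hopLinGraphC F k K Vk (recordCtC F k K Vk (B - hopLinGraphC F k K Vk (recordDt F k K Vk ρ B))) = B :=
  recordPsi_recordPhi F Vk (Dt := recordDt F k K Vk ρ) (fun _ hB' => (recordDt_spec F k K hk Vk hε hε50 hVk hb hHop hq hρ hB').2) hB

include hk hε hε50 hVk hb hHop hq hρ in
/-- ★ **`Φ ∘ Ψ = id` ON `ball (ρ∕2)`**: for `‖B′‖ < ρ∕2`, `‖Ψ B′‖ < ρ` and `Φ(Ψ B′) = B′`. [cite: Balaban1987RG1, p.267–268] -/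
theorem recordPhi_recordPsi_recordDt_of_norm_lt {B' : FluctIdx F k K → ℂ} (hB' : ‖B'‖ < ρ / 2) :
    ‖B' + hopLinGraphC F k K Vk (recordCtC F k K Vk B')‖ < ρ ∧
      (B' + hopLinGraphC F k K Vk (recordCtC F k K Vk B')) -
          hopLinGraphC F k K Vk (recordDt F k K Vk ρ (B' + hopLinGraphC F k K Vk (recordCtC F k K Vk B'))) = B' :=
  recordPhi_recordPsi_of_norm_lt hk Vk hε hε50 hVk hb hHop hq hρ (fun _ hB => (recordDt_spec F k K hk Vk hε hε50 hVk hb hHop hq hρ hB).1)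
    (fun _ hB => (recordDt_spec F k K hk Vk hε hε50 hVk hb hHop hq hρ hB).2) hB'

include hk hε hε50 hVk hb hHop hq hρ in
/-- ★ every `‖B′‖ < ρ∕2` is `Φ(B)` for exactly one `‖B‖ < ρ`. [cite: Balaban1987RG1, p.267–268] -/
theorem existsUnique_recordPhi_recordDt_eq {B' : FluctIdx F k K → ℂ} (hB' : ‖B'‖ < ρ / 2) :
    ∃! B : FluctIdx F k K → ℂ, ‖B‖ < ρ ∧ B - hopLinGraphC F k K Vk (recordDt F k K Vk ρ B) = B' :=
  existsUnique_recordPhi_eq hk Vk hε hε50 hVk hb hHop hq hρ (fun _ hB => (recordDt_spec F k K hk Vk hε hε50 hVk hb hHop hq hρ hB).1)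
    (fun _ hB => (recordDt_spec F k K hk Vk hε hε50 hVk hb hHop hq hρ hB).2) hB'

/-! ## §2  `D̃` is Lipschitz, hence continuous, on `ball ρ` -/

include hk hε hε50 hVk hb hHop hq hρ in
/-- ★ **`D̃` IS LIPSCHITZ ON THE BALL**: `(1 − 9C₂bρ)·‖D̃ B₁ − D̃ B₂‖ ≤ 9C₂ρ·‖B₁ − B₂‖` for `‖B₁‖, ‖B₂‖ < ρ` — `D̃ Bᵢ = C̃_ℂ(Φ Bᵢ)` with `Φ Bᵢ` in the `2ρ`-ball, the `9C₂ρ`-Lipschitz bound of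
`C̃_ℂ` there, and `‖Φ B₁ − Φ B₂‖ ≤ ‖B₁ − B₂‖ + b‖D̃ B₁ − D̃ B₂‖`. [cite: Balaban1985Variational, (53)–(54) p.286, (98) p.292; Balaban1987RG1, p.267] -/
theorem norm_recordDt_sub_le {B₁ B₂ : FluctIdx F k K → ℂ} (hB₁ : ‖B₁‖ < ρ) (hB₂ : ‖B₂‖ < ρ) :
    (1 - 9 * (2 * 1 / (1 / (10 ^ 8 * (F.P K).d * (F.P K).L)) ^ 2) * b * ρ) * ‖recordDt F k K Vk ρ B₁ - recordDt F k K Vk ρ B₂‖ ≤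
      9 * (2 * 1 / (1 / (10 ^ 8 * (F.P K).d * (F.P K).L)) ^ 2) * ρ * ‖B₁ - B₂‖ := by
  have hρ0 : 0 < ρ := (norm_nonneg _).trans_lt hB₁
  have hC₂0 : (0 : ℝ) ≤ 2 * 1 / (1 / (10 ^ 8 * (F.P K).d * (F.P K).L)) ^ 2 := by positivity
  have hY₁ := norm_recordPhi_recordDt_lt hk Vk hε hε50 hVk hb hHop hq hρ hB₁
  have hY₂ := norm_recordPhi_recordDt_lt hk Vk hε hε50 hVk hb hHop hq hρ hB₂
  have hlip := norm_recordCtC_sub_le F k K hk Vk hε hε50 hVk hρ hY₁ hY₂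
  rw [← recordDt_eq_recordCtC_recordPhi hk Vk hε hε50 hVk hb hHop hq hρ hB₁,
    ← recordDt_eq_recordCtC_recordPhi hk Vk hε hε50 hVk hb hHop hq hρ hB₂] at hlip
  have hdiff : B₁ - hopLinGraphC F k K Vk (recordDt F k K Vk ρ B₁) - (B₂ - hopLinGraphC F k K Vk (recordDt F k K Vk ρ B₂)) =
      (B₁ - B₂) - hopLinGraphC F k K Vk (recordDt F k K Vk ρ B₁ - recordDt F k K Vk ρ B₂) := by
    rw [map_sub]; abel
  have hΦ : ‖B₁ - hopLinGraphC F k K Vk (recordDt F k K Vk ρ B₁) - (B₂ - hopLinGraphC F k K Vk (recordDt F k K Vk ρ B₂))‖ ≤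
      ‖B₁ - B₂‖ + b * ‖recordDt F k K Vk ρ B₁ - recordDt F k K Vk ρ B₂‖ := by
    rw [hdiff]
    exact (norm_sub_le _ _).trans (add_le_add le_rfl (hHop _))
  have h9 : 0 ≤ 9 * (2 * 1 / (1 / (10 ^ 8 * (F.P K).d * (F.P K).L)) ^ 2) * ρ := by positivity
  have := hlip.trans (mul_le_mul_of_nonneg_left hΦ h9)
  nlinarith [this]

include hk hε hε50 hVk hb hHop hq hρ in
/-- `D̃` is Lipschitz-on-with the constant `9C₂ρ∕(1 − 9C₂bρ)` on `ball ρ`. [cite: Balaban1985Variational, (98) p.292; Balaban1987RG1, p.267] -/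
theorem lipschitzOnWith_recordDt_ball :
    LipschitzOnWith (Real.toNNReal (9 * (2 * 1 / (1 / (10 ^ 8 * (F.P K).d * (F.P K).L)) ^ 2) * ρ /
        (1 - 9 * (2 * 1 / (1 / (10 ^ 8 * (F.P K).d * (F.P K).L)) ^ 2) * b * ρ)))
      (recordDt F k K Vk ρ) (ball (0 : FluctIdx F k K → ℂ) ρ) := by
  refine LipschitzOnWith.of_dist_le_mul fun B₁ hB₁ B₂ hB₂ => ?_
  have hB₁' := mem_ball_zero_iff.1 hB₁
  have hB₂' := mem_ball_zero_iff.1 hB₂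
  have hρ0 : 0 < ρ := (norm_nonneg _).trans_lt hB₁'
  have hC₂0 : (0 : ℝ) ≤ 2 * 1 / (1 / (10 ^ 8 * (F.P K).d * (F.P K).L)) ^ 2 := by positivity
  have hθ : 0 < 1 - 9 * (2 * 1 / (1 / (10 ^ 8 * (F.P K).d * (F.P K).L)) ^ 2) * b * ρ := sub_pos.2 hq
  have hK : 0 ≤ 9 * (2 * 1 / (1 / (10 ^ 8 * (F.P K).d * (F.P K).L)) ^ 2) * ρ /
      (1 - 9 * (2 * 1 / (1 / (10 ^ 8 * (F.P K).d * (F.P K).L)) ^ 2) * b * ρ) := by positivity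
  rw [Real.coe_toNNReal _ hK, dist_eq_norm, dist_eq_norm, div_mul_eq_mul_div, le_div_iff₀ hθ]
  have := norm_recordDt_sub_le hk Vk hε hε50 hVk hb hHop hq hρ hB₁' hB₂'
  linarith

include hk hε hε50 hVk hb hHop hq hρ in
/-- `D̃` is continuous on `ball ρ`. [cite: Balaban1987RG1, p.267] -/
theorem continuousOn_recordDt_ball : ContinuousOn (recordDt F k K Vk ρ) (ball (0 : FluctIdx F k K → ℂ) ρ) :=
  (lipschitzOnWith_recordDt_ball hk Vk hε hε50 hVk hb hHop hq hρ).continuousOn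

include hk hε hε50 hVk hb hHop hq hρ in
/-- `D̃` is continuous at every `‖B‖ < ρ`. [cite: Balaban1987RG1, p.267] -/
theorem continuousAt_recordDt {B : FluctIdx F k K → ℂ} (hB : ‖B‖ < ρ) : ContinuousAt (recordDt F k K Vk ρ) B :=
  (continuousOn_recordDt_ball hk Vk hε hε50 hVk hb hHop hq hρ).continuousAt (isOpen_ball.mem_nhds (mem_ball_zero_iff.2 hB))

/-! ## §3  `D̃` is Fréchet-holomorphic: the derivatives of `Φ` and `D̃` -/

include hk hε hε50 hVk hb hHop hq hρ in
/-- ★★ **`DΦ(B) = (DΨ(Φ B))⁻¹`**: `Φ(B) = B − h_ℂD̃(B)` has Fréchet derivative `Ring.inverse (1 + h_ℂ ∘L DC̃_ℂ(Φ B))` at every `‖B‖ < ρ` (inverse-function bookkeeping: `Ψ ∘ Φ = id` near `B`, `Φ`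
continuous at `B`, `Ψ` differentiable at `Φ B` with a unit derivative). [cite: Balaban1987RG1, p.267–268, (2.12) p.268] -/
theorem hasFDerivAt_recordPhi {B : FluctIdx F k K → ℂ} (hB : ‖B‖ < ρ) :
    HasFDerivAt (fun B => B - hopLinGraphC F k K Vk (recordDt F k K Vk ρ B))
      (Ring.inverse ((1 : (FluctIdx F k K → ℂ) →L[ℂ] (FluctIdx F k K → ℂ)) +
        (LinearMap.toContinuousLinearMap (hopLinGraphC F k K Vk)).comp
          (fderiv ℂ (recordCtC F k K Vk) (B - hopLinGraphC F k K Vk (recordDt F k K Vk ρ B))))) B := by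
  have hY := norm_recordPhi_recordDt_lt hk Vk hε hε50 hVk hb hHop hq hρ hB
  have hYR : ‖B - hopLinGraphC F k K Vk (recordDt F k K Vk ρ B)‖ < 1 / (10 ^ 8 * (F.P K).d * (F.P K).L) := by linarith [norm_nonneg B]
  obtain ⟨-, hu⟩ := isUnit_fderiv_recordPsi_of_lt_two_mul F k K hk Vk hε hε50 hVk hb hHop hq hρ hY
  set u := hu.unit with hudef
  have hcoe : ((ContinuousLinearEquiv.ofUnit u : (FluctIdx F k K → ℂ) ≃L[ℂ] (FluctIdx F k K → ℂ)) :
      (FluctIdx F k K → ℂ) →L[ℂ] (FluctIdx F k K → ℂ)) =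
      (1 : (FluctIdx F k K → ℂ) →L[ℂ] (FluctIdx F k K → ℂ)) +
        (LinearMap.toContinuousLinearMap (hopLinGraphC F k K Vk)).comp
          (fderiv ℂ (recordCtC F k K Vk) (B - hopLinGraphC F k K Vk (recordDt F k K Vk ρ B))) := by
    ext x; rfl
  have hf : HasFDerivAt (fun B' : FluctIdx F k K → ℂ => B' + hopLinGraphC F k K Vk (recordCtC F k K Vk B'))
      ((ContinuousLinearEquiv.ofUnit u : (FluctIdx F k K → ℂ) ≃L[ℂ] (FluctIdx F k K → ℂ)) : (FluctIdx F k K → ℂ) →L[ℂ] (FluctIdx F k K → ℂ))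
      (B - hopLinGraphC F k K Vk (recordDt F k K Vk ρ B)) := by
    rw [hcoe]; exact hasFDerivAt_recordPsi F k K hk Vk hε hε50 hVk hYR
  have hg : ContinuousAt (fun B => B - hopLinGraphC F k K Vk (recordDt F k K Vk ρ B)) B :=
    continuousAt_id.sub ((LinearMap.toContinuousLinearMap (hopLinGraphC F k K Vk)).continuous.continuousAt.comp
      (continuousAt_recordDt hk Vk hε hε50 hVk hb hHop hq hρ hB))
  have hfg : ∀ᶠ y in 𝓝 B, (y - hopLinGraphC F k K Vk (recordDt F k K Vk ρ y)) +
      hopLinGraphC F k K Vk (recordCtC F k K Vk (y - hopLinGraphC F k K Vk (recordDt F k K Vk ρ y))) = y := by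
    filter_upwards [isOpen_ball.mem_nhds (mem_ball_zero_iff.2 hB)] with y hy
    exact recordPsi_recordPhi_recordDt hk Vk hε hε50 hVk hb hHop hq hρ (mem_ball_zero_iff.1 hy)
  have h := HasFDerivAt.of_local_left_inverse hg hf hfg
  have hsymm : (((ContinuousLinearEquiv.ofUnit u).symm : (FluctIdx F k K → ℂ) ≃L[ℂ] (FluctIdx F k K → ℂ)) :
      (FluctIdx F k K → ℂ) →L[ℂ] (FluctIdx F k K → ℂ)) = ((u⁻¹ : ((FluctIdx F k K → ℂ) →L[ℂ] (FluctIdx F k K → ℂ))ˣ) :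
        (FluctIdx F k K → ℂ) →L[ℂ] (FluctIdx F k K → ℂ)) := by
    ext x; rfl
  rw [hsymm, ← Ring.inverse_unit, hudef, IsUnit.unit_spec] at h
  exact h

include hk hε hε50 hVk hb hHop hq hρ in
/-- ★★★ **`D̃` IS FRÉCHET-DIFFERENTIABLE**: `DD̃(B) = DC̃_ℂ(Φ B) ∘L (DΨ(Φ B))⁻¹` at every `‖B‖ < ρ` (chain rule on `D̃ = C̃_ℂ ∘ Φ`, valid on the open ball). [cite: Balaban1987RG1, p.267 («an analytic function of B»)] -/
theorem hasFDerivAt_recordDt {B : FluctIdx F k K → ℂ} (hB : ‖B‖ < ρ) :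
    HasFDerivAt (recordDt F k K Vk ρ)
      ((fderiv ℂ (recordCtC F k K Vk) (B - hopLinGraphC F k K Vk (recordDt F k K Vk ρ B))).comp
        (Ring.inverse ((1 : (FluctIdx F k K → ℂ) →L[ℂ] (FluctIdx F k K → ℂ)) +
          (LinearMap.toContinuousLinearMap (hopLinGraphC F k K Vk)).comp
            (fderiv ℂ (recordCtC F k K Vk) (B - hopLinGraphC F k K Vk (recordDt F k K Vk ρ B)))))) B := by
  have hY := norm_recordPhi_recordDt_lt hk Vk hε hε50 hVk hb hHop hq hρ hB
  have hYR : ‖B - hopLinGraphC F k K Vk (recordDt F k K Vk ρ B)‖ < 1 / (10 ^ 8 * (F.P K).d * (F.P K).L) := by linarith [norm_nonneg B]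
  have hC : HasFDerivAt (recordCtC F k K Vk) (fderiv ℂ (recordCtC F k K Vk) (B - hopLinGraphC F k K Vk (recordDt F k K Vk ρ B)))
      (B - hopLinGraphC F k K Vk (recordDt F k K Vk ρ B)) :=
    (differentiableAt_recordCtC F k K hk Vk hε hε50 hVk hYR).hasFDerivAt
  have hcomp := hC.comp B (hasFDerivAt_recordPhi hk Vk hε hε50 hVk hb hHop hq hρ hB)
  refine hcomp.congr_of_eventuallyEq ?_
  filter_upwards [isOpen_ball.mem_nhds (mem_ball_zero_iff.2 hB)] with y hy
  exact recordDt_eq_recordCtC_recordPhi hk Vk hε hε50 hVk hb hHop hq hρ (mem_ball_zero_iff.1 hy)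

include hk hε hε50 hVk hb hHop hq hρ in
/-- ★★★ `D̃` is ℂ-differentiable on `ball ρ`. [cite: Balaban1987RG1, p.267] -/
theorem differentiableOn_recordDt_ball : DifferentiableOn ℂ (recordDt F k K Vk ρ) (ball (0 : FluctIdx F k K → ℂ) ρ) := fun _ hB =>
  (hasFDerivAt_recordDt hk Vk hε hε50 hVk hb hHop hq hρ (mem_ball_zero_iff.1 hB)).differentiableAt.differentiableWithinAt

include hk hε hε50 hVk hb hHop hq hρ in
/-- ★★★ **«D̃(B) … IS AN ANALYTIC FUNCTION OF B» — FULL FRÉCHET SENSE**: `recordDt Vk ρ` is analytic (a convergent Taylor series at every point) on the open ball `‖B‖ < ρ` ([Chae1985] Thm 14.13 on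
§3's differentiability). [cite: Balaban1987RG1, p.267; Balaban1985Variational, (96)–(98) p.292] -/
theorem analyticOnNhd_recordDt_ball : AnalyticOnNhd ℂ (recordDt F k K Vk ρ) (ball (0 : FluctIdx F k K → ℂ) ρ) :=
  Literature.Analysis.Complex.HolomorphicBanach.analyticOnNhd_of_differentiableOn
    (differentiableOn_recordDt_ball hk Vk hε hε50 hVk hb hHop hq hρ) isOpen_ball

/-! ## §4  The Jacobian identity and its determinant -/

include hk hε hε50 hVk hb hHop hq hρ in
/-- ★★★ **THE JACOBIAN IDENTITY** `1 − h_ℂ ∘L DD̃(B) = Ring.inverse (DΨ(Φ B))` for `‖B‖ < ρ` (both are the derivative of `Φ` at `B`). [cite: Balaban1987RG1, (2.12) p.268 («Tr log(I − h(δ∕δB)D̃)»), p.267] -/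
theorem one_sub_hop_comp_fderiv_recordDt {B : FluctIdx F k K → ℂ} (hB : ‖B‖ < ρ) :
    (1 : (FluctIdx F k K → ℂ) →L[ℂ] (FluctIdx F k K → ℂ)) -
        (LinearMap.toContinuousLinearMap (hopLinGraphC F k K Vk)).comp (fderiv ℂ (recordDt F k K Vk ρ) B) =
      Ring.inverse ((1 : (FluctIdx F k K → ℂ) →L[ℂ] (FluctIdx F k K → ℂ)) +
        (LinearMap.toContinuousLinearMap (hopLinGraphC F k K Vk)).comp
          (fderiv ℂ (recordCtC F k K Vk) (B - hopLinGraphC F k K Vk (recordDt F k K Vk ρ B)))) := by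
  have hD := hasFDerivAt_recordDt hk Vk hε hε50 hVk hb hHop hq hρ hB
  have h1 : HasFDerivAt (fun B => B - hopLinGraphC F k K Vk (recordDt F k K Vk ρ B))
      ((1 : (FluctIdx F k K → ℂ) →L[ℂ] (FluctIdx F k K → ℂ)) -
        (LinearMap.toContinuousLinearMap (hopLinGraphC F k K Vk)).comp (fderiv ℂ (recordDt F k K Vk ρ) B)) B := by
    have := (hasFDerivAt_id B).sub ((LinearMap.toContinuousLinearMap (hopLinGraphC F k K Vk)).hasFDerivAt.comp B
      hD.differentiableAt.hasFDerivAt)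
    exact this
  exact h1.unique (hasFDerivAt_recordPhi hk Vk hε hε50 hVk hb hHop hq hρ hB)

include hk hε hε50 hVk hb hHop hq hρ in
/-- ★★ **BOTH PRODUCTS ARE `1`**: `DΨ(Φ B) * (1 − h_ℂ∘DD̃(B)) = 1` and `(1 − h_ℂ∘DD̃(B)) * DΨ(Φ B) = 1` in the Banach algebra `𝒴 →L[ℂ] 𝒴`. [cite: Balaban1987RG1, (2.12) p.268] -/
theorem fderiv_recordPsi_mul_one_sub_hop_comp_fderiv_recordDt {B : FluctIdx F k K → ℂ} (hB : ‖B‖ < ρ) :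
    ((1 : (FluctIdx F k K → ℂ) →L[ℂ] (FluctIdx F k K → ℂ)) +
        (LinearMap.toContinuousLinearMap (hopLinGraphC F k K Vk)).comp
          (fderiv ℂ (recordCtC F k K Vk) (B - hopLinGraphC F k K Vk (recordDt F k K Vk ρ B)))) *
        ((1 : (FluctIdx F k K → ℂ) →L[ℂ] (FluctIdx F k K → ℂ)) -
          (LinearMap.toContinuousLinearMap (hopLinGraphC F k K Vk)).comp (fderiv ℂ (recordDt F k K Vk ρ) B)) = 1 ∧
      ((1 : (FluctIdx F k K → ℂ) →L[ℂ] (FluctIdx F k K → ℂ)) -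
          (LinearMap.toContinuousLinearMap (hopLinGraphC F k K Vk)).comp (fderiv ℂ (recordDt F k K Vk ρ) B)) *
        ((1 : (FluctIdx F k K → ℂ) →L[ℂ] (FluctIdx F k K → ℂ)) +
          (LinearMap.toContinuousLinearMap (hopLinGraphC F k K Vk)).comp
            (fderiv ℂ (recordCtC F k K Vk) (B - hopLinGraphC F k K Vk (recordDt F k K Vk ρ B)))) = 1 := by
  have hY := norm_recordPhi_recordDt_lt hk Vk hε hε50 hVk hb hHop hq hρ hB
  obtain ⟨-, hu⟩ := isUnit_fderiv_recordPsi_of_lt_two_mul F k K hk Vk hε hε50 hVk hb hHop hq hρ hY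
  rw [one_sub_hop_comp_fderiv_recordDt hk Vk hε hε50 hVk hb hHop hq hρ hB]
  exact ⟨Ring.mul_inverse_cancel _ hu, Ring.inverse_mul_cancel _ hu⟩

include hk hε hε50 hVk hb hHop hq hρ in
/-- ★★ **`det(1 − h_ℂ∘DD̃(B)) · det(DΨ(Φ B)) = 1`** for `‖B‖ < ρ`. [cite: Balaban1987RG1, (2.12) p.268] -/
theorem det_one_sub_hop_comp_fderiv_recordDt_mul {B : FluctIdx F k K → ℂ} (hB : ‖B‖ < ρ) :
    LinearMap.det (((1 : (FluctIdx F k K → ℂ) →L[ℂ] (FluctIdx F k K → ℂ)) -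
          (LinearMap.toContinuousLinearMap (hopLinGraphC F k K Vk)).comp (fderiv ℂ (recordDt F k K Vk ρ) B)).toLinearMap) *
      LinearMap.det (((1 : (FluctIdx F k K → ℂ) →L[ℂ] (FluctIdx F k K → ℂ)) +
          (LinearMap.toContinuousLinearMap (hopLinGraphC F k K Vk)).comp
            (fderiv ℂ (recordCtC F k K Vk) (B - hopLinGraphC F k K Vk (recordDt F k K Vk ρ B)))).toLinearMap) = 1 := by
  have h := (fderiv_recordPsi_mul_one_sub_hop_comp_fderiv_recordDt hk Vk hε hε50 hVk hb hHop hq hρ hB).2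
  have hmul : ∀ f g : (FluctIdx F k K → ℂ) →L[ℂ] (FluctIdx F k K → ℂ),
      ((f * g : (FluctIdx F k K → ℂ) →L[ℂ] (FluctIdx F k K → ℂ)) : (FluctIdx F k K → ℂ) →ₗ[ℂ] (FluctIdx F k K → ℂ)) =
        (f : (FluctIdx F k K → ℂ) →ₗ[ℂ] (FluctIdx F k K → ℂ)) * (g : (FluctIdx F k K → ℂ) →ₗ[ℂ] (FluctIdx F k K → ℂ)) := fun _ _ => rfl
  have hone : ((1 : (FluctIdx F k K → ℂ) →L[ℂ] (FluctIdx F k K → ℂ)) : (FluctIdx F k K → ℂ) →ₗ[ℂ] (FluctIdx F k K → ℂ)) = 1 := rfl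
  have h' := congrArg (fun f : (FluctIdx F k K → ℂ) →L[ℂ] (FluctIdx F k K → ℂ) => LinearMap.det (f : (FluctIdx F k K → ℂ) →ₗ[ℂ] (FluctIdx F k K → ℂ))) h
  simp only [hmul, hone, map_mul, map_one] at h'
  exact h'

include hk hε hε50 hVk hb hHop hq hρ in
/-- `det(DΨ(Φ B)) ≠ 0`. [cite: Balaban1987RG1, (2.12) p.268] -/
theorem det_fderiv_recordPsi_recordPhi_ne_zero {B : FluctIdx F k K → ℂ} (hB : ‖B‖ < ρ) :
    LinearMap.det (((1 : (FluctIdx F k K → ℂ) →L[ℂ] (FluctIdx F k K → ℂ)) +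
        (LinearMap.toContinuousLinearMap (hopLinGraphC F k K Vk)).comp
          (fderiv ℂ (recordCtC F k K Vk) (B - hopLinGraphC F k K Vk (recordDt F k K Vk ρ B)))).toLinearMap) ≠ 0 := by
  intro h0
  have h := det_one_sub_hop_comp_fderiv_recordDt_mul hk Vk hε hε50 hVk hb hHop hq hρ hB
  rw [h0, mul_zero] at h
  exact zero_ne_one h

include hk hε hε50 hVk hb hHop hq hρ in
/-- ★★ **PRINT's JACOBIAN AS AN INVERSE DETERMINANT**: `det(1 − h_ℂ∘DD̃(B)) = (det(1 + h_ℂ∘DC̃_ℂ(B′)))⁻¹` at `B′ = Φ(B)`, `‖B‖ < ρ` — the (o3) determinant is carried by the explicit holomorphic family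
`B′ ↦ 1 + h_ℂ∘DC̃_ℂ(B′)`. [cite: Balaban1987RG1, (2.12) p.268, p.267] -/
theorem det_one_sub_hop_comp_fderiv_recordDt_eq_inv {B : FluctIdx F k K → ℂ} (hB : ‖B‖ < ρ) :
    LinearMap.det (((1 : (FluctIdx F k K → ℂ) →L[ℂ] (FluctIdx F k K → ℂ)) -
          (LinearMap.toContinuousLinearMap (hopLinGraphC F k K Vk)).comp (fderiv ℂ (recordDt F k K Vk ρ) B)).toLinearMap) =
      (LinearMap.det (((1 : (FluctIdx F k K → ℂ) →L[ℂ] (FluctIdx F k K → ℂ)) +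
          (LinearMap.toContinuousLinearMap (hopLinGraphC F k K Vk)).comp
            (fderiv ℂ (recordCtC F k K Vk) (B - hopLinGraphC F k K Vk (recordDt F k K Vk ρ B)))).toLinearMap))⁻¹ :=
  eq_inv_of_mul_eq_one_left (det_one_sub_hop_comp_fderiv_recordDt_mul hk Vk hε hε50 hVk hb hHop hq hρ hB)

end Letters

end Summit.QuantumFields.YangMills.Theorems.BalabanUVNodesPortS1

end
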